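import Summits.NavierStokesRegularity.NavierStokesRegularity.Theorems.PoloidalWindowDoorPoloidalWindowRigidityZShockNoetherEnergyCoercive
import Summits.NavierStokesRegularity.NavierStokesRegularity.Theorems.PoloidalWindowDoorPoloidalWindowRigidityZShockSliceTyping
import Summits.NavierStokesRegularity.NavierStokesRegularity.Theorems.PoloidalWindowDoorPoloidalWindowRigidityZShockLocalEnergyLocal
import HarnessLib

/-!
# Crux K2 `PoloidalWindowRigidity` (stmt-NavierStokesRegularity-19708), line `z_shock` — R3 entrance, EXACT form: the cone-local centred
# NOETHER energy of an autonomous-column slice is NON-INCREASING in the height (domain of dependence with NO exponential factor)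

`--supports stmt-NavierStokesRegularity-19708 --as helper` (leafhand-ns-poloidalwindowdoor-3 g7, cell decomp-ns, 2026-08-31).  Class-free,
def-free; tree files only (`…ZShockNoetherEnergyCoercive` p828484, `…ZShockNoetherLaws` p825599, `…ZShockSliceTyping` p827234,
`…ZShockLocalEnergyLocal` p827335).  **No stub and no summit is closed by this file; Navier–Stokes regularity is NOT proved here (rung 0).**

WHAT.  `noetherConeEnergy_le`: let `f : ℝ³ → ℝ³` be a smooth slice and `Γ, Ψ` smooth with `Γ' = G`, `Ψ' = Γ`, centred at a value `w⋆`
(`Γ(w⋆) = 0`).  Suppose that at every point of the truncated solid cone `{t₀ ≤ s ≤ t, ‖y‖ ≤ √(1+ρ²) + ĉ(t−s) + 1}` charted by the tree's slice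
chart `pt c 1 s y = c + hor y + s e₂` (height = coordinate `2`) the slice is divergence-free, obeys the autonomous slope law
`∂₂f_b = G(f₂)·∂_b f₂` (`b = 0, 1`), and takes height-values in an interval `[α, β] ∋ w⋆` on which `G ≤ −cmin² < 0` and `|G| ≤ cmax²`
(strict hyperbolicity of the window), with `ĉ = cmax²/cmin`.  Then the centred Noether energy
`e = Ψ(w⋆) − Ψ(f₂) + ½(f₀² + f₁²)` satisfies

  `∫_{‖y‖ ≤ ρ} e(t, y) dy ≤ ∫_{‖y‖ ≤ √(1+ρ²) + ĉ(t−t₀) + 1} e(t₀, y) dy`.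

HOW.  `…NoetherEnergyCoercive.noetherBalance_of_slope` (the exact z-translation law of p825599 in balance form, zero source) is moved to the
`(s, y)` typing by the dictionary of `…SliceTyping` (`deriv_slice_height`, `fderiv_slice_horizontal`); positivity and flux domination are
`noetherEnergy_coercive` / `noetherFlux_le_energy`; the cone inequality is `…LocalEnergyLocal.setIntegral_closedBall_le_exp_mul_local` with
`σ = 0`, `K = 0` (`exp 0 = 1`).  Compared with `…ZShockConeEnergy.coneEnergy_of_class_autonomy` (p827814: the NON-conserved wave energy
`½w_z² + ½c²|∇ₕw|²`, Grönwall factor `e^{K(t−t₁)}`), this is the EXACT monotone quantity the card's R3 paragraph asks for («the energy–momentum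
Noether laws give monotone weighted fluxes along acoustic cones»); towards decreasing height use `…SliceTyping`'s height reversal.  It proves
no rigidity: R3 (two-sided eternal rigidity in `2+1` dimensions) remains open and not in print. [folklore]
-/

noncomputable section

namespace Summit.NavierStokesRegularity.NavierStokesRegularity.Theorems.PoloidalWindowDoorPoloidalWindowRigidityZShockNoetherConeEnergy

-- the summit and its single sub-problem share the name (CONVENTIONS §1)
set_option linter.dupNamespace false

open Set Filter Topology Function MeasureTheory Metric
open scoped ContDiff
open Literature.Analysis Literature.Analysis.FluidPDE
open Summit.NavierStokesRegularity.NavierStokesRegularity.Theorems.PoloidalWindowDoorPoloidalWindowRigidityHorizontalMean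
open Summit.NavierStokesRegularity.NavierStokesRegularity.Theorems.PoloidalWindowDoorPoloidalWindowRigidityZShockSliceTyping
open Summit.NavierStokesRegularity.NavierStokesRegularity.Theorems.PoloidalWindowDoorPoloidalWindowRigidityZShockNoetherEnergyCoercive
open Summit.NavierStokesRegularity.NavierStokesRegularity.Theorems.PoloidalWindowDoorPoloidalWindowRigidityZShockLocalEnergyLocal

/-- Cauchy–Schwarz in the plane, in coordinates: `|y₀a + y₁b| ≤ ‖y‖·√(a² + b²)`. [folklore] -/
theorem abs_inner_two_le (y : EuclideanSpace ℝ (Fin 2)) (a b : ℝ) :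
    |y 0 * a + y 1 * b| ≤ ‖y‖ * Real.sqrt (a ^ 2 + b ^ 2) := by
  have hn : ‖y‖ = Real.sqrt (y 0 ^ 2 + y 1 ^ 2) := by
    rw [EuclideanSpace.norm_eq, Fin.sum_univ_two]
    simp [Real.norm_eq_abs, sq_abs]
  rw [hn, ← Real.sqrt_mul (by positivity), ← Real.sqrt_sq_eq_abs]
  apply Real.sqrt_le_sqrt
  nlinarith [sq_nonneg (y 0 * b - y 1 * a)]

/-- **The cone-local centred Noether energy is non-increasing in the height** (exact domain of dependence, no exponential factor).  See the
module docstring for the statement and the proof route. [folklore] -/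
theorem noetherConeEnergy_le {f : EuclideanSpace ℝ (Fin 3) → EuclideanSpace ℝ (Fin 3)} {G Γ Ψ : ℝ → ℝ}
    {c : EuclideanSpace ℝ (Fin 3)} {α β wstar cmin cmax t₀ t ρ : ℝ}
    (hf : ContDiff ℝ ∞ f) (hΓs : ContDiff ℝ ∞ Γ) (hΨs : ContDiff ℝ ∞ Ψ)
    (hΓ : ∀ r, HasDerivAt Γ (G r) r) (hΨ : ∀ r, HasDerivAt Ψ (Γ r) r) (hΓ0 : Γ wstar = 0) (hwstar : wstar ∈ Icc α β)
    (hcmin : 0 < cmin) (hG : ∀ r ∈ Icc α β, G r ≤ -cmin ^ 2) (hGb : ∀ r ∈ Icc α β, |G r| ≤ cmax ^ 2) (ht : t₀ ≤ t)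
    (hcone : ∀ s ∈ Icc t₀ t, ∀ y : EuclideanSpace ℝ (Fin 2), ‖y‖ ≤ √(1 + ρ ^ 2) + cmax ^ 2 / cmin * (t - s) + 1 →
      f (pt c 1 s y) 2 ∈ Icc α β ∧ VectorCalculus.divergence f (pt c 1 s y) = 0 ∧
      ∀ b : Fin 3, b ≠ 2 → fderiv ℝ f (pt c 1 s y) (EuclideanSpace.single 2 1) b =
        G (f (pt c 1 s y) 2) * fderiv ℝ f (pt c 1 s y) (EuclideanSpace.single b 1) 2) :
    ∫ y in closedBall (0 : EuclideanSpace ℝ (Fin 2)) ρ,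
        (Ψ wstar - Ψ (f (pt c 1 t y) 2) + (1 / 2) * (f (pt c 1 t y) 0 ^ 2 + f (pt c 1 t y) 1 ^ 2)) ≤
      ∫ y in closedBall (0 : EuclideanSpace ℝ (Fin 2)) (√(1 + ρ ^ 2) + cmax ^ 2 / cmin * (t - t₀) + 1),
        (Ψ wstar - Ψ (f (pt c 1 t₀ y) 2) + (1 / 2) * (f (pt c 1 t₀ y) 0 ^ 2 + f (pt c 1 t₀ y) 1 ^ 2)) := by
  -- the densities on `ℝ³` (opaque local names with defining equations)
  have hfi : ∀ i : Fin 3, ContDiff ℝ ∞ fun x => f x i := fun i => (EuclideanSpace.proj (𝕜 := ℝ) i).contDiff.comp hf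
  have hfd : Differentiable ℝ f := hf.differentiable (by simp)
  obtain ⟨E3, hE3_def⟩ : ∃ E3 : EuclideanSpace ℝ (Fin 3) → ℝ,
      E3 = fun x => Ψ wstar - Ψ (f x 2) + (1 / 2) * (f x 0 ^ 2 + f x 1 ^ 2) := ⟨_, rfl⟩
  obtain ⟨P, hP_def⟩ : ∃ P : Fin 2 → EuclideanSpace ℝ (Fin 3) → ℝ,
      P = fun i x => Γ (f x 2) * f x (Fin.castSucc i) := ⟨_, rfl⟩
  have hP0 : (fun x => Γ (f x 2) * f x 0) = P 0 := by rw [hP_def]; rfl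
  have hP1 : (fun x => Γ (f x 2) * f x 1) = P 1 := by rw [hP_def]; rfl
  have hE3 : ContDiff ℝ ∞ E3 := by
    rw [hE3_def]
    exact (contDiff_const.sub (hΨs.comp (hfi 2))).add (contDiff_const.mul (((hfi 0).pow 2).add ((hfi 1).pow 2)))
  have hP : ∀ i, ContDiff ℝ ∞ (P i) := by
    intro i; rw [hP_def]; exact (hΓs.comp (hfi 2)).mul (hfi _)
  have hE3d : Differentiable ℝ E3 := hE3.differentiable (by simp)
  have hPd : ∀ i, Differentiable ℝ (P i) := fun i => (hP i).differentiable (by simp)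
  -- the `(s, y)`-typed density, fluxes and (zero) source
  obtain ⟨e, he_def⟩ : ∃ e : ℝ → EuclideanSpace ℝ (Fin 2) → ℝ, e = fun s y => E3 (pt c 1 s y) := ⟨_, rfl⟩
  obtain ⟨fl, hfl_def⟩ : ∃ fl : Fin 2 → ℝ → EuclideanSpace ℝ (Fin 2) → ℝ, fl = fun i s y => -P i (pt c 1 s y) := ⟨_, rfl⟩
  obtain ⟨σ, hσ_def⟩ : ∃ σ : ℝ → EuclideanSpace ℝ (Fin 2) → ℝ, σ = fun _ _ => 0 := ⟨_, rfl⟩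
  have he : ContDiff ℝ ∞ (uncurry e) := by rw [he_def]; exact contDiff_slice_uncurry hE3 c
  have hfl : ∀ i, ContDiff ℝ ∞ (uncurry (fl i)) := by
    intro i
    have hfun : uncurry (fl i) = fun q => -(uncurry (fun s y => P i (pt c 1 s y)) q) := by
      funext q; simp [hfl_def, uncurry]
    rw [hfun]
    exact (contDiff_slice_uncurry (hP i) c).neg
  have hσ : ContDiff ℝ ∞ (uncurry σ) := by
    have hfun : uncurry σ = fun _ => (0 : ℝ) := by funext q; simp [hσ_def, uncurry]
    rw [hfun]; exact contDiff_const
  -- the balance law on the cone (zero source)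
  have hbal : ∀ s ∈ Icc t₀ t, ∀ y : EuclideanSpace ℝ (Fin 2), ‖y‖ ≤ √(1 + ρ ^ 2) + cmax ^ 2 / cmin * (t - s) + 1 →
      deriv (fun s' => e s' y) s + ∑ i, fderiv ℝ (fl i s) y (EuclideanSpace.single i 1) = σ s y := by
    intro s hs y hy
    obtain ⟨hval, hdiv, hslope⟩ := hcone s hs y hy
    have hlaw := noetherBalance_of_slope (hfd _) (hΓ _) (hΨ _) hslope hdiv wstar
    rw [← hE3_def, hP0, hP1] at hlaw
    have h1 : deriv (fun s' => e s' y) s = fderiv ℝ E3 (pt c 1 s y) (EuclideanSpace.single 2 1) := by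
      rw [he_def]; exact deriv_slice_height (hE3d _)
    have h2 : ∀ i : Fin 2, fderiv ℝ (fl i s) y (EuclideanSpace.single i 1) =
        -fderiv ℝ (P i) (pt c 1 s y) (EuclideanSpace.single (Fin.castSucc i) 1) := by
      intro i
      have : fl i s = fun y' => -P i (pt c 1 s y') := by rw [hfl_def]
      rw [this, fderiv_fun_neg, neg_apply, fderiv_slice_horizontal ((hPd i) _)]
    rw [Fin.sum_univ_two, h1, h2, h2, hσ_def, castSucc_zero_two, castSucc_one_two]
    linarith
  -- positivity and flux domination on the cone
  have hseg : ∀ {w : ℝ}, w ∈ Icc α β → uIcc wstar w ⊆ Icc α β := fun hw => uIcc_subset_Icc hwstar hw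
  have hes : ∀ s y, e s y = Ψ wstar - Ψ (f (pt c 1 s y) 2) + (1 / 2) * (f (pt c 1 s y) 0 ^ 2 + f (pt c 1 s y) 1 ^ 2) := by
    intro s y; rw [he_def, hE3_def]
  have hpos : ∀ s ∈ Icc t₀ t, ∀ y : EuclideanSpace ℝ (Fin 2), ‖y‖ ≤ √(1 + ρ ^ 2) + cmax ^ 2 / cmin * (t - s) + 1 → 0 ≤ e s y := by
    intro s hs y hy
    obtain ⟨hval, -, -⟩ := hcone s hs y hy
    have hV : 0 ≤ (1 / 2) * (f (pt c 1 s y) 0 ^ 2 + f (pt c 1 s y) 1 ^ 2) := by positivity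
    rw [hes]
    exact (noetherEnergy_coercive (w := f (pt c 1 s y) 2) hΓ hΨ hΓ0 (fun r hr => hG r (hseg hval hr)) hV).2
  have hflux : ∀ s ∈ Icc t₀ t, ∀ y : EuclideanSpace ℝ (Fin 2), ‖y‖ ≤ √(1 + ρ ^ 2) + cmax ^ 2 / cmin * (t - s) + 1 →
      0 ≤ cmax ^ 2 / cmin * √(1 + ‖y‖ ^ 2) * e s y + ∑ i, y i * fl i s y := by
    intro s hs y hy
    have he0 := hpos s hs y hy
    obtain ⟨hval, -, -⟩ := hcone s hs y hy
    rw [hes] at he0 ⊢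
    set x := pt c 1 s y with hx
    have hq : 0 ≤ Real.sqrt (f x 0 ^ 2 + f x 1 ^ 2) := Real.sqrt_nonneg _
    have hdom := noetherFlux_le_energy (w := f x 2) hΓ hΨ hΓ0 hcmin (fun r hr => hG r (hseg hval hr))
      (fun r hr => hGb r (hseg hval hr)) hq
    rw [Real.sq_sqrt (by positivity)] at hdom
    have hsum : ∑ i, y i * fl i s y = -(Γ (f x 2) * (y 0 * f x 0 + y 1 * f x 1)) := by
      rw [Fin.sum_univ_two, hfl_def, hP_def]
      simp only [castSucc_zero_two, castSucc_one_two, ← hx]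
      ring
    rw [hsum]
    have hcs := abs_inner_two_le y (f x 0) (f x 1)
    have hbr : ‖y‖ ≤ √(1 + ‖y‖ ^ 2) := by
      have h0 : 0 ≤ ‖y‖ := norm_nonneg _
      calc ‖y‖ = √(‖y‖ ^ 2) := (Real.sqrt_sq h0).symm
        _ ≤ √(1 + ‖y‖ ^ 2) := Real.sqrt_le_sqrt (by linarith)
    have h1 : |Γ (f x 2) * (y 0 * f x 0 + y 1 * f x 1)| ≤
        √(1 + ‖y‖ ^ 2) * (cmax ^ 2 / cmin * (Ψ wstar - Ψ (f x 2) + (1 / 2) * (f x 0 ^ 2 + f x 1 ^ 2))) := by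
      rw [abs_mul]
      calc |Γ (f x 2)| * |y 0 * f x 0 + y 1 * f x 1|
          ≤ |Γ (f x 2)| * (‖y‖ * Real.sqrt (f x 0 ^ 2 + f x 1 ^ 2)) := mul_le_mul_of_nonneg_left hcs (abs_nonneg _)
        _ = ‖y‖ * (|Γ (f x 2)| * Real.sqrt (f x 0 ^ 2 + f x 1 ^ 2)) := by ring
        _ ≤ √(1 + ‖y‖ ^ 2) * (cmax ^ 2 / cmin * (Ψ wstar - Ψ (f x 2) + (1 / 2) * (f x 0 ^ 2 + f x 1 ^ 2))) :=
          mul_le_mul hbr hdom (mul_nonneg (abs_nonneg _) hq) (Real.sqrt_nonneg _)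
    have h2 := le_abs_self (Γ (f x 2) * (y 0 * f x 0 + y 1 * f x 1))
    have hcomm : cmax ^ 2 / cmin * √(1 + ‖y‖ ^ 2) * (Ψ wstar - Ψ (f x 2) + (1 / 2) * (f x 0 ^ 2 + f x 1 ^ 2)) =
        √(1 + ‖y‖ ^ 2) * (cmax ^ 2 / cmin * (Ψ wstar - Ψ (f x 2) + (1 / 2) * (f x 0 ^ 2 + f x 1 ^ 2))) := by ring
    rw [hcomm]
    linarith
  have hsrc : ∀ s ∈ Icc t₀ t, ∀ y : EuclideanSpace ℝ (Fin 2), ‖y‖ ≤ √(1 + ρ ^ 2) + cmax ^ 2 / cmin * (t - s) + 1 →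
      σ s y ≤ 0 * e s y := fun s _ y _ => by simp [hσ_def]
  have hmain := setIntegral_closedBall_le_exp_mul_local he hfl hσ ht ρ hbal hpos hflux hsrc
  rw [zero_mul, Real.exp_zero, one_mul] at hmain
  simp only [hes] at hmain
  exact hmain

end Summit.NavierStokesRegularity.NavierStokesRegularity.Theorems.PoloidalWindowDoorPoloidalWindowRigidityZShockNoetherConeEnergy
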